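import Summits.ResolutionOfSingularities.ResolutionOfSingularities.Theorems.FrobeniusLadderFInjectiveMacaulayficationClauseOfPderivNotMem
import Mathlib.Algebra.MvPolynomial.PDeriv
import Mathlib.Algebra.CharP.Algebra
import Mathlib.Tactic.LinearCombination
import HarnessLib

/-!
# ROWC row F161 at `p = 5`: the off-axis clause `hoff` — `V(g)` is REGULAR off the `t`-axis
# (crux `FInjectiveMacaulayfication` stmt-ResolutionOfSingularities-15315, relative filtered engine v2; RULING R16.6 (2) of res-L1-w45a-plan-1)

Support file for crux stmt-ResolutionOfSingularities-15315 (`FrobeniusLadder.FInjectiveMacaulayfication`), chain w45a, seat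
res-L1-w45a-stub-4 g6. [OURS · L1 W4.5a; template = res-L1-w45a-stub-2's `RelGddF008Regular` (residue-domain chain); HOFF: F161 is an ∅-row
(`Sing X ∖ L = ∅`, residue-domain chain below)] — NOT a statement of the manuscript; AI-written, weaker than
expert review.

For the diagonal form `g = z² + t⁴y²w⁴ + (y² + x³)³ + t·y⁴w² + x¹¹ + w⁷` of F161 (`…RelGddF161Data`) over any field of characteristic `5`:
at every maximal ideal `Q` of `k[x,y,z,w,t]/(g)` missing some `x̄ⱼ`, `j ∈ {x,y,z,w}`, some partial derivative of `g` is NOT in `Q`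
(`eq_zero_of_jacobian`: in a domain of characteristic `5`, `g = ∇g = 0` forces `x = y = z = w = 0` — `∂_z = 2z`; if `w = 0` then
`∂_y` gives `yφ² = 0` and `g` gives `φ³ + x¹¹ = 0`, whence `x = y = 0` as for F008; if `w ≠ 0` then `∂_t = y²w²(4t³w² + y²)`:
`y = 0` makes `∂_w` read `7w⁶ = 0`; else `y² = t³w²` (`t ≠ 0`), `φ² = −t⁴w⁴` (`∂_y`), `t⁷ = −2w` (`w·∂_w`), `x²(x⁸ − φ²) = 0`
(`∂_x`), `φ³ + x¹¹ + 2w⁷ = 0` (`g`); `x = 0` gives `t² = −1` and `t² = 1`; `x⁸ = φ²` gives `t⁴(φ + x³) = 2w³`, `t⁴x³ = 2w³`,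
`x³ = −54t¹⁷`, `φ = −45t¹⁷ = 0`, `t⁴w⁴ = 0` — absurd), so the local ring is regular and satisfies the clause (`ClauseOfPderivNotMem`).
Main theorem `g_offL_clause_char5` = the engine's `hoff` for `n = 5`, `J = {0,1,2,3}`, `p = 5`.  No definitions, no named facts. [folklore]
-/

-- single-problem summit: the doubled namespace component is forced
set_option linter.dupNamespace false

noncomputable section

namespace Summit.ResolutionOfSingularities.ResolutionOfSingularities.Theorems.FInjectiveMacaulayfication.RelGddF161Regular

open MvPolynomial
open Summit.ResolutionOfSingularities.ResolutionOfSingularities.Theorems.FInjectiveMacaulayfication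

/-- **THE RESIDUE-DOMAIN CHAIN.** In a domain `R` of characteristic `5`, the five equations `∇g = 0` together with `g = 0` force
`x = y = z = w = 0`. [folklore] -/
theorem eq_zero_of_jacobian {R : Type} [CommRing R] [IsDomain R] (h5 : (5 : R) = 0) (x y z w t : R)
    (eg : z ^ 2 + t ^ 4 * y ^ 2 * w ^ 4 + (y ^ 2 + x ^ 3) ^ 3 + t * y ^ 4 * w ^ 2 + x ^ 11 + w ^ 7 = 0)
    (e0 : 9 * x ^ 2 * (y ^ 2 + x ^ 3) ^ 2 + 11 * x ^ 10 = 0)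
    (e1 : 2 * t ^ 4 * y * w ^ 4 + 6 * y * (y ^ 2 + x ^ 3) ^ 2 + 4 * t * y ^ 3 * w ^ 2 = 0)
    (e2 : 2 * z = 0)
    (e3 : 4 * t ^ 4 * y ^ 2 * w ^ 3 + 2 * t * y ^ 4 * w + 7 * w ^ 6 = 0)
    (e4 : 4 * t ^ 3 * y ^ 2 * w ^ 4 + y ^ 4 * w ^ 2 = 0) :
    x = 0 ∧ y = 0 ∧ z = 0 ∧ w = 0 := by
  have h23 : (2 : R) * 3 = 1 := by linear_combination h5
  have hz : z = 0 := by linear_combination 3 * e2 - z * h5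
  by_cases hw : w = 0
  · /- CASE `w = 0` (exactly as for F192: the terms `ty⁴w²`, `4ty³w²` vanish) -/
    have f1 : y * (y ^ 2 + x ^ 3) ^ 2 = 0 := by
      linear_combination e1 - y * (y ^ 2 + x ^ 3) ^ 2 * h5 - (2 * t ^ 4 * y * w ^ 3 + 4 * t * y ^ 3 * w) * hw
    have fg : (y ^ 2 + x ^ 3) ^ 3 + x ^ 11 = 0 := by
      linear_combination eg - z * hz - (t ^ 4 * y ^ 2 * w ^ 3 + t * y ^ 4 * w + w ^ 6) * hw
    by_cases hy : y = 0
    · by_cases hx : x = 0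
      · exact ⟨hx, hy, hz, hw⟩
      · exfalso
        have h1 : x ^ 8 * (11 * x ^ 2 + 9) = 0 := by
          linear_combination e0 - 9 * x ^ 2 * ((y ^ 2 + x ^ 3) + x ^ 3) * y * hy
        have h2 : x ^ 9 * (x ^ 2 + 1) = 0 := by
          linear_combination fg - ((y ^ 2 + x ^ 3) ^ 2 + (y ^ 2 + x ^ 3) * x ^ 3 + x ^ 6) * y * hy
        have h1' : 11 * x ^ 2 + 9 = 0 := (mul_eq_zero.mp h1).resolve_left (pow_ne_zero 8 hx)
        have h2' : x ^ 2 + 1 = 0 := (mul_eq_zero.mp h2).resolve_left (pow_ne_zero 9 hx)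
        have h20 : (2 : R) = 0 := by linear_combination -h1' + 11 * h2'
        have : (1 : R) = 0 := by linear_combination -h23 + 3 * h20
        exact one_ne_zero this
    · exfalso
      have hφ2 : (y ^ 2 + x ^ 3) ^ 2 = 0 := (mul_eq_zero.mp f1).resolve_left hy
      have hφ : y ^ 2 + x ^ 3 = 0 := pow_eq_zero_iff (two_ne_zero) |>.mp hφ2
      have hx11 : x ^ 11 = 0 := by linear_combination fg - (y ^ 2 + x ^ 3) ^ 2 * hφ
      have hx : x = 0 := pow_eq_zero_iff (by norm_num) |>.mp hx11
      have hy2 : y ^ 2 = 0 := by linear_combination hφ - x ^ 2 * hx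
      exact hy (pow_eq_zero_iff two_ne_zero |>.mp hy2)
  · /- CASE `w ≠ 0`: `∂_t = y²w²(4t³w² + y²)`; `y = 0` makes `∂_w` read `7w⁶ = 0`; `y² = t³w²` runs into `t⁴w⁴ = 0` -/
    exfalso
    have hw6 : ∀ (_ : y = 0), False := fun hy => by
      have h : w ^ 6 = 0 := by
        linear_combination 3 * e3 - (3 * 4 * t ^ 4 * y * w ^ 3 + 3 * 2 * t * y ^ 3 * w) * hy - (4 * w ^ 6) * h5
      exact hw (pow_eq_zero_iff (by norm_num) |>.mp h)
    by_cases hy : y = 0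
    · exact hw6 hy
    have f4 : w ^ 2 * (y ^ 2 * (4 * t ^ 3 * w ^ 2 + y ^ 2)) = 0 := by linear_combination e4
    have hq : 4 * t ^ 3 * w ^ 2 + y ^ 2 = 0 :=
      (mul_eq_zero.mp ((mul_eq_zero.mp f4).resolve_left (pow_ne_zero 2 hw))).resolve_left (pow_ne_zero 2 hy)
    have hq' : y ^ 2 - t ^ 3 * w ^ 2 = 0 := by linear_combination hq - t ^ 3 * w ^ 2 * h5
    have ht : t ≠ 0 := fun ht => hy (pow_eq_zero_iff two_ne_zero |>.mp
      (show y ^ 2 = 0 by linear_combination hq' + t ^ 2 * w ^ 2 * ht))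
    -- `∂_y / y`: `φ² + t⁴w⁴ = 0`
    have r1 : 2 * t ^ 4 * w ^ 4 + 6 * (y ^ 2 + x ^ 3) ^ 2 + 4 * t * y ^ 2 * w ^ 2 = 0 :=
      (mul_eq_zero.mp (show y * (2 * t ^ 4 * w ^ 4 + 6 * (y ^ 2 + x ^ 3) ^ 2 + 4 * t * y ^ 2 * w ^ 2) = 0 by
        linear_combination e1)).resolve_left hy
    have E1 : (y ^ 2 + x ^ 3) ^ 2 + t ^ 4 * w ^ 4 = 0 := by
      linear_combination r1 - 4 * t * w ^ 2 * hq' - ((y ^ 2 + x ^ 3) ^ 2 + t ^ 4 * w ^ 4) * h5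
    -- `w·∂_w`: `t⁷ + 2w = 0`
    have E2a : w ^ 6 * (t ^ 7 + 2 * w) = 0 := by
      linear_combination w * e3 - (4 * t ^ 4 * w ^ 4 + 2 * t * w ^ 2 * (y ^ 2 + t ^ 3 * w ^ 2)) * hq' - (t ^ 7 * w ^ 6 + w ^ 7) * h5
    have E2 : t ^ 7 + 2 * w = 0 := (mul_eq_zero.mp E2a).resolve_left (pow_ne_zero 6 hw)
    -- `∂_x`: `x²(x⁸ - φ²) = 0`; `g`: `φ³ + x¹¹ + 2w⁷ = 0`
    have E3 : x ^ 2 * (x ^ 8 - (y ^ 2 + x ^ 3) ^ 2) = 0 := by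
      linear_combination e0 - 2 * (x ^ 10 + x ^ 2 * (y ^ 2 + x ^ 3) ^ 2) * h5
    have E4 : (y ^ 2 + x ^ 3) ^ 3 + x ^ 11 + 2 * w ^ 7 = 0 := by
      linear_combination eg - z * hz - (t ^ 4 * w ^ 4 + t * w ^ 2 * (y ^ 2 + t ^ 3 * w ^ 2)) * hq' - 2 * w ^ 6 * E2 + w ^ 7 * h5
    rcases mul_eq_zero.mp E3 with hx2 | E3'
    · -- `x = 0`: `φ = t³w²`, `t² = -1`, `t⁹ = -2w = t⁷`, `t² = 1`
      have hx : x = 0 := pow_eq_zero_iff two_ne_zero |>.mp hx2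
      have hφy : (y ^ 2 + x ^ 3) - t ^ 3 * w ^ 2 = 0 := by linear_combination hq' + x ^ 2 * hx
      have E5a : t ^ 4 * w ^ 4 * (t ^ 2 + 1) = 0 := by linear_combination E1 - ((y ^ 2 + x ^ 3) + t ^ 3 * w ^ 2) * hφy
      have E5 : t ^ 2 + 1 = 0 := (mul_eq_zero.mp E5a).resolve_left (mul_ne_zero (pow_ne_zero 4 ht) (pow_ne_zero 4 hw))
      have E6a : w ^ 6 * (t ^ 9 + 2 * w) = 0 := by
        linear_combination E4 - ((y ^ 2 + x ^ 3) ^ 2 + (y ^ 2 + x ^ 3) * t ^ 3 * w ^ 2 + t ^ 6 * w ^ 4) * hφy - x ^ 10 * hx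
      have E6 : t ^ 9 + 2 * w = 0 := (mul_eq_zero.mp E6a).resolve_left (pow_ne_zero 6 hw)
      have E7 : t ^ 7 * (t ^ 2 - 1) = 0 := by linear_combination E6 - E2
      rcases mul_eq_zero.mp E7 with h7 | E8
      · exact ht (pow_eq_zero_iff (by norm_num) |>.mp h7)
      · have h2 : (2 : R) = 0 := by linear_combination E5 - E8
        exact one_ne_zero (show (1 : R) = 0 by linear_combination 3 * h2 - h5)
    · -- `x⁸ = φ²`: `t⁴(φ + x³) = 2w³`, `w = -3t⁷`, `t⁴x³ = 2w³`, `x³ = -54t¹⁷`, `φ = 0`, `t⁴w⁴ = 0`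
      have E7a : w ^ 4 * (t ^ 4 * ((y ^ 2 + x ^ 3) + x ^ 3) - 2 * w ^ 3) = 0 := by
        linear_combination -(E4) + ((y ^ 2 + x ^ 3) + x ^ 3) * E1 + x ^ 3 * E3'
      have E7' : t ^ 4 * ((y ^ 2 + x ^ 3) + x ^ 3) - 2 * w ^ 3 = 0 := (mul_eq_zero.mp E7a).resolve_left (pow_ne_zero 4 hw)
      have Ew : w + 3 * t ^ 7 = 0 := by linear_combination 3 * E2 - w * h5
      have E8a : 2 * (t ^ 4 * x ^ 3 - 2 * w ^ 3) = 0 := by linear_combination E7' - t ^ 4 * hq' - w ^ 2 * E2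
      have E8' : t ^ 4 * x ^ 3 - 2 * w ^ 3 = 0 := by linear_combination 3 * E8a - (t ^ 4 * x ^ 3 - 2 * w ^ 3) * h5
      have E9a : t ^ 4 * (x ^ 3 + 54 * t ^ 17) = 0 := by
        linear_combination E8' + 2 * (w ^ 2 - 3 * t ^ 7 * w + 9 * t ^ 14) * Ew
      have E9 : x ^ 3 + 54 * t ^ 17 = 0 := (mul_eq_zero.mp E9a).resolve_left (pow_ne_zero 4 ht)
      have E10 : y ^ 2 + x ^ 3 = 0 := by
        linear_combination hq' + t ^ 3 * (w - 3 * t ^ 7) * Ew + E9 - 9 * t ^ 17 * h5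
      have E11 : t ^ 4 * w ^ 4 = 0 := by linear_combination E1 - (y ^ 2 + x ^ 3) * E10
      rcases mul_eq_zero.mp E11 with h | h
      · exact ht (pow_eq_zero_iff (by norm_num) |>.mp h)
      · exact hw (pow_eq_zero_iff (by norm_num) |>.mp h)

/-- **THE OFF-AXIS CLAUSE `hoff` FOR `g = z² + t⁴y²w⁴ + (y² + x³)³ + t·y⁴w² + x¹¹ + w⁷` AT `p = 5`** (RGDD-L row F161, diagonalised form):
at every maximal ideal `Q` of `k[X]/(g)` missing some `x̄ⱼ`, `j ∈ {0,1,2,3}`, the local ring satisfies the Cohen–Macaulay + Frobenius-closed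
clause — `V(g)` is regular off the `t`-axis (Jacobian: some partial is a unit at `Q`, by `eq_zero_of_jacobian` in the residue domain, then
`ClauseOfPderivNotMem`). Exact binder shape = the engine's `hoff` for `n = 5`, `J = {0,1,2,3}`, `p = 5`.
[cite: Matsumura1987, Thm. 30.4 (ii)] -/
theorem g_offL_clause_char5 (k : Type) [Field k] [CharP k 5] (g : MvPolynomial (Fin 5) k)
    (hg : g = X 2 ^ 2 + X 4 ^ 4 * X 1 ^ 2 * X 3 ^ 4 + (X 1 ^ 2 + X 0 ^ 3) ^ 3 + X 4 * X 1 ^ 4 * X 3 ^ 2 + X 0 ^ 11 + X 3 ^ 7) :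
    ∀ (Q : Ideal (MvPolynomial (Fin 5) k ⧸ Ideal.span {g})) [Q.IsMaximal],
      (∃ j ∈ ({0, 1, 2, 3} : Finset (Fin 5)), Ideal.Quotient.mk (Ideal.span {g}) (MvPolynomial.X j) ∉ Q) →
      ∀ d : ℕ, ringKrullDim (Localization.AtPrime Q) = d → ∀ s : Fin d → Localization.AtPrime Q,
        (Ideal.span (Set.range s)).radical.IsMaximal →
          RingTheory.Sequence.IsWeaklyRegular (Localization.AtPrime Q) (List.ofFn s) ∧
          ∀ y : Localization.AtPrime Q, (∃ e : ℕ, y ^ 5 ^ e ∈ Ideal.span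
            ((fun z : Localization.AtPrime Q => z ^ 5 ^ e) ''
              (Ideal.span (Set.range s) : Set (Localization.AtPrime Q)))) → y ∈ Ideal.span (Set.range s) := by
  haveI : Fact (Nat.Prime 5) := ⟨by norm_num⟩
  intro Q _ hj d hd s hs
  -- the five partial derivatives
  have hd0 : pderiv 0 g = 9 * X 0 ^ 2 * (X 1 ^ 2 + X 0 ^ 3) ^ 2 + 11 * X 0 ^ 10 := by
    rw [hg]
    simp only [map_add, Derivation.leibniz, pderiv_pow, pderiv_X_self, smul_eq_mul,
      pderiv_X_of_ne (show (1 : Fin 5) ≠ 0 by decide), pderiv_X_of_ne (show (2 : Fin 5) ≠ 0 by decide),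
      pderiv_X_of_ne (show (3 : Fin 5) ≠ 0 by decide), pderiv_X_of_ne (show (4 : Fin 5) ≠ 0 by decide)]
    norm_num
    ring
  have hd1 : pderiv 1 g = 2 * X 4 ^ 4 * X 1 * X 3 ^ 4 + 6 * X 1 * (X 1 ^ 2 + X 0 ^ 3) ^ 2 + 4 * X 4 * X 1 ^ 3 * X 3 ^ 2 := by
    rw [hg]
    simp only [map_add, Derivation.leibniz, pderiv_pow, pderiv_X_self, smul_eq_mul,
      pderiv_X_of_ne (show (0 : Fin 5) ≠ 1 by decide), pderiv_X_of_ne (show (2 : Fin 5) ≠ 1 by decide),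
      pderiv_X_of_ne (show (3 : Fin 5) ≠ 1 by decide), pderiv_X_of_ne (show (4 : Fin 5) ≠ 1 by decide)]
    norm_num
    ring
  have hd2 : pderiv 2 g = 2 * X 2 := by
    rw [hg]
    simp only [map_add, Derivation.leibniz, pderiv_pow, pderiv_X_self, smul_eq_mul,
      pderiv_X_of_ne (show (0 : Fin 5) ≠ 2 by decide), pderiv_X_of_ne (show (1 : Fin 5) ≠ 2 by decide),
      pderiv_X_of_ne (show (3 : Fin 5) ≠ 2 by decide), pderiv_X_of_ne (show (4 : Fin 5) ≠ 2 by decide)]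
    norm_num
  have hd3 : pderiv 3 g = 4 * X 4 ^ 4 * X 1 ^ 2 * X 3 ^ 3 + 2 * X 4 * X 1 ^ 4 * X 3 + 7 * X 3 ^ 6 := by
    rw [hg]
    simp only [map_add, Derivation.leibniz, pderiv_pow, pderiv_X_self, smul_eq_mul,
      pderiv_X_of_ne (show (0 : Fin 5) ≠ 3 by decide), pderiv_X_of_ne (show (1 : Fin 5) ≠ 3 by decide),
      pderiv_X_of_ne (show (2 : Fin 5) ≠ 3 by decide), pderiv_X_of_ne (show (4 : Fin 5) ≠ 3 by decide)]
    norm_num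
    ring
  have hd4 : pderiv 4 g = 4 * X 4 ^ 3 * X 1 ^ 2 * X 3 ^ 4 + X 1 ^ 4 * X 3 ^ 2 := by
    rw [hg]
    simp only [map_add, Derivation.leibniz, pderiv_pow, pderiv_X_self, smul_eq_mul,
      pderiv_X_of_ne (show (0 : Fin 5) ≠ 4 by decide), pderiv_X_of_ne (show (1 : Fin 5) ≠ 4 by decide),
      pderiv_X_of_ne (show (2 : Fin 5) ≠ 4 by decide), pderiv_X_of_ne (show (3 : Fin 5) ≠ 4 by decide)]
    norm_num
    ring
  -- Jacobian exits: some partial is not in `P = Q ∩ k[X]`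
  by_cases m0 : pderiv 0 g ∈ Q.comap (Ideal.Quotient.mk (Ideal.span {g})); swap
  · exact ClauseOfPderivNotMem.stub_clauseOfPderivNotMem 5 k 5 g Q 0 m0 d hd s hs
  by_cases m1 : pderiv 1 g ∈ Q.comap (Ideal.Quotient.mk (Ideal.span {g})); swap
  · exact ClauseOfPderivNotMem.stub_clauseOfPderivNotMem 5 k 5 g Q 1 m1 d hd s hs
  by_cases m2 : pderiv 2 g ∈ Q.comap (Ideal.Quotient.mk (Ideal.span {g})); swap
  · exact ClauseOfPderivNotMem.stub_clauseOfPderivNotMem 5 k 5 g Q 2 m2 d hd s hs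
  by_cases m3 : pderiv 3 g ∈ Q.comap (Ideal.Quotient.mk (Ideal.span {g})); swap
  · exact ClauseOfPderivNotMem.stub_clauseOfPderivNotMem 5 k 5 g Q 3 m3 d hd s hs
  by_cases m4 : pderiv 4 g ∈ Q.comap (Ideal.Quotient.mk (Ideal.span {g})); swap
  · exact ClauseOfPderivNotMem.stub_clauseOfPderivNotMem 5 k 5 g Q 4 m4 d hd s hs
  -- all partials in `P`: impossible off `L`, by the residue-domain chain
  exfalso
  haveI hPmax : (Q.comap (Ideal.Quotient.mk (Ideal.span {g}))).IsMaximal :=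
    Ideal.comap_isMaximal_of_surjective _ Ideal.Quotient.mk_surjective
  have hgP : g ∈ Q.comap (Ideal.Quotient.mk (Ideal.span {g})) := by
    rw [Ideal.mem_comap, Ideal.Quotient.eq_zero_iff_mem.mpr (Ideal.mem_span_singleton_self g)]
    exact Q.zero_mem
  -- the residue domain `R = k[X] / P` has characteristic `5`
  haveI : Nontrivial (MvPolynomial (Fin 5) k ⧸ Q.comap (Ideal.Quotient.mk (Ideal.span {g}))) :=
    Ideal.Quotient.nontrivial_iff.mpr hPmax.ne_top
  haveI : CharP (MvPolynomial (Fin 5) k ⧸ Q.comap (Ideal.Quotient.mk (Ideal.span {g}))) 5 :=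
    charP_of_injective_algebraMap
      (algebraMap k (MvPolynomial (Fin 5) k ⧸ Q.comap (Ideal.Quotient.mk (Ideal.span {g})))).injective 5
  have h5 : (5 : MvPolynomial (Fin 5) k ⧸ Q.comap (Ideal.Quotient.mk (Ideal.span {g}))) = 0 := by
    simpa using CharP.cast_eq_zero (MvPolynomial (Fin 5) k ⧸ Q.comap (Ideal.Quotient.mk (Ideal.span {g}))) 5
  set π := Ideal.Quotient.mk (Q.comap (Ideal.Quotient.mk (Ideal.span {g}))) with hπdef
  have hπ : ∀ a : MvPolynomial (Fin 5) k, a ∈ Q.comap (Ideal.Quotient.mk (Ideal.span {g})) → π a = 0 :=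
    fun a ha => Ideal.Quotient.eq_zero_iff_mem.mpr ha
  -- the six equations in the residue domain
  have eg : π (X 2 ^ 2 + X 4 ^ 4 * X 1 ^ 2 * X 3 ^ 4 + (X 1 ^ 2 + X 0 ^ 3) ^ 3 + X 4 * X 1 ^ 4 * X 3 ^ 2 + X 0 ^ 11 + X 3 ^ 7) = 0 := by
    rw [← hg]
    exact hπ g hgP
  have e0 := hπ _ m0
  have e1 := hπ _ m1
  have e2 := hπ _ m2
  have e3 := hπ _ m3
  have e4 := hπ _ m4
  rw [hd0] at e0
  rw [hd1] at e1
  rw [hd2] at e2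
  rw [hd3] at e3
  rw [hd4] at e4
  simp only [map_add, map_mul, map_pow, map_ofNat] at eg e0 e1 e2 e3 e4
  obtain ⟨hx, hy, hz, hw⟩ := eq_zero_of_jacobian h5 (π (X 0)) (π (X 1)) (π (X 2)) (π (X 3)) (π (X 4)) eg e0 e1 e2 e3 e4
  -- but some `x̄ⱼ ∉ Q`, `j ≤ 3`
  obtain ⟨j, hjJ, hjQ⟩ := hj
  apply hjQ
  have key : ∀ i : Fin 5, π (X i) = 0 → Ideal.Quotient.mk (Ideal.span {g}) (X i) ∈ Q := fun i hi =>
    Ideal.mem_comap.mp (Ideal.Quotient.eq_zero_iff_mem.mp hi)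
  simp only [Finset.mem_insert, Finset.mem_singleton] at hjJ
  rcases hjJ with rfl | rfl | rfl | rfl
  · exact key 0 hx
  · exact key 1 hy
  · exact key 2 hz
  · exact key 3 hw

end Summit.ResolutionOfSingularities.ResolutionOfSingularities.Theorems.FInjectiveMacaulayfication.RelGddF161Regular

end
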